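import Literature.NumberTheory.PAdicHodge.UnramifiedWittPeriodMatrix
import Literature.NumberTheory.PAdicHodge.FontaineThetaGalois
import Literature.NumberTheory.PAdicHodge.FontaineThetaLocalField
import Literature.NumberTheory.PAdicHodge.AxSenTate
import HarnessLib

/-!
# The `Γ_F`-fixed Witt vectors `W(k̄)^{Γ_F} = W(k_F)` and the embeddings `W(k_F) → 𝒪_F`, `W(k_F) → 𝔸_inf(F)`

Topic `Literature/NumberTheory/PAdicHodge`; uses `UnramifiedWittVectors` (`wittToAinf : W(k̄) → 𝔸_inf(F)`,
`galAinf_wittToAinf`), `UnramifiedWittPeriodMatrix` (`wittGal = 𝕎(σ̄)`), `FontaineThetaGalois` (`θ` is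
`Γ_F`-equivariant), `AxSenTate` (`ℂ_F^{Γ_F} = F`).

For a `p`-adic field `F` with residue field `k_F` and `k̄` the residue field of `𝒪̂_{F^nr}`, the ring
`W(k_F) = 𝒪_{F₀}` of integers of the maximal unramified subfield `F₀ ⊆ F` is realised INSIDE `W(k̄)` as the
subring of Witt vectors fixed by `Γ_F` (acting through `Gal(k̄/k_F)`, Witt functoriality):

* §1 `wittToC hp : W(k̄) → ℂ_F`, `x ↦ θ(𝕎(ι₀♭) x)` — norm `≤ 1`, `Γ_F`-equivariant (`smul_wittToC`);
* §2 **`wittFixed F p = W(k̄)^{Γ_F}`** (a `Subring`; `mem_wittFixed_iff`), containing the Teichmüller lifts of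
  `k̄^{Γ_F} = k_F`;
* §3 **`wittFixedToF hp : W(k̄)^{Γ_F} → F`** — the image of a fixed Witt vector in `ℂ_F` is `Γ_F`-fixed, hence in
  `F` (Ax–Sen–Tate, tree `CompletedAlgClosure.fixedPoints_eq_range_algebraMap`) and of norm `≤ 1`, hence in `𝒪_F`
  (`wittFixedToInt`); `algebraMap_wittFixedToF` identifies it in `ℂ_F`;
* §4 **`wittFixedToAinf hp : W(k̄)^{Γ_F} → 𝔸_inf(F)`** with `θ ∘ wittFixedToAinf = wittFixedToIntC`
  (`fontaineTheta_wittFixedToAinf`) and **`Γ_F` FIXES its image** (`galAinf_wittFixedToAinf`) — the coefficient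
  embedding of the ramified Fontaine ring `𝔸_inf(F)[X]/(E)` for an Eisenstein polynomial `E` over `W(k_F)` (sequel
  `EisensteinRootWittDatum`), i.e. of `𝒪_F ⊗_{W(k_F)} 𝔸_inf(F)` for a RAMIFIED `F` of residue degree `f ≥ 1`.

The instance facts `p ∉ (𝒪̂_{F^nr})ˣ`, `char k̄ = p`, `p ∉ 𝒪_{ℂ_F}ˣ`, `𝒪_{ℂ_F}` `p`-adically complete all follow
from `hp : |p|_F < 1` (tree `not_isUnit_natCast_completion`, `charP_residueField_completion`,
`not_isUnit_natCast_integerC`, `isAdicComplete_integerC_natCast`); the DEFINITIONS take only `hp` and supply them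
internally, the theorems relating them to `wittToAinf`/`θ` are stated under the usual instance hypotheses (all
`Prop`s, so the two agree definitionally).

Definitions: `wittToC`, `wittFixed`, `wittFixedToF`, `wittFixedToInt`, `wittFixedToIntC`, `wittFixedToAinf`.
No named facts, no instances, no `sorry`.

## References
* [SerreLocalFields1979] J.-P. Serre, *Local Fields* (GTM 67, 1979), Ch. II §5 Thm. 3–4 and Prop. 10 (`W(k)`,
  functoriality, `W(k_F) = 𝒪_{F₀}`), Ch. III §5 (structure of `𝒪_F` over `𝒪_{F₀}`).
* [FontaineAsterisque223III] J.-M. Fontaine, *Le corps des périodes p-adiques*, Astérisque 223 (1994), Exp. II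
  §1.2 (`W(k̄) ⊆ 𝔸_inf`, `θ`).
* [FontaineOuyang2022] J.-M. Fontaine, Y. Ouyang, *Theory of p-adic Galois representations*, §4.4, Prop. 3.8
  (Ax–Sen–Tate `ℂ_F^{Γ_F} = F`).
-/

noncomputable section

open ValuativeRel Field Ideal WittVector IsLocalRing

namespace Literature.NumberTheory.PAdicHodge

open Literature.NumberTheory.GaloisRepresentations
open Literature.NumberTheory.GaloisRepresentations.IsNonarchimedeanLocalField

variable {F : Type} [Field F] [ValuativeRel F] [TopologicalSpace F] [IsNonarchimedeanLocalField F]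
  [CharZero F] {p : ℕ} [Fact p.Prime]

/-! ## §1 `W(k̄) → ℂ_F` -/

variable (F p) in
/-- **`W(k̄) → ℂ_F`, `x ↦ θ(𝕎(ι₀♭) x)`**: the composite `W(k̄) → 𝔸_inf(F) → 𝒪_{ℂ_F} ⊆ ℂ_F` of the tree maps
`wittToAinf` and Fontaine's `θ` (the instance facts being supplied from `hp`). [cite: FontaineAsterisque223III, Exp. II §1.2] -/
def wittToC (hp : valuation F p < 1) : WittVector p (ResidueField (maxUnramifiedCompletion F)) →+* CompletedAlgClosure F :=
  haveI : Fact (¬ IsUnit (p : maxUnramifiedCompletion F)) := ⟨not_isUnit_natCast_completion hp⟩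
  haveI : CharP (ResidueField (maxUnramifiedCompletion F)) p := charP_residueField_completion
  haveI : Fact (¬ IsUnit (p : integerC F)) := ⟨not_isUnit_natCast_integerC hp⟩
  haveI : IsAdicComplete (Ideal.span {(p : integerC F)}) (integerC F) := isAdicComplete_integerC_natCast hp
  (integerC F).subtype.comp ((fontaineTheta (integerC F) p).comp (wittToAinf F p))

section Instances

variable [Fact (¬ IsUnit (p : maxUnramifiedCompletion F))] [CharP (ResidueField (maxUnramifiedCompletion F)) p]
  [Fact (¬ IsUnit (p : integerC F))] [IsAdicComplete (Ideal.span {(p : integerC F)}) (integerC F)]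

/-- `wittToC x = θ (wittToAinf x)` in `ℂ_F`. [cite: FontaineAsterisque223III, Exp. II §1.2] -/
theorem wittToC_apply (hp : valuation F p < 1) (x : WittVector p (ResidueField (maxUnramifiedCompletion F))) :
    wittToC F p hp x = ((fontaineTheta (integerC F) p (wittToAinf F p x) : integerC F) : CompletedAlgClosure F) := rfl

end Instances

/-- **`‖wittToC x‖ ≤ 1`** (the image lies in `𝒪_{ℂ_F}`). [cite: FontaineAsterisque223III, Exp. II §1.2] -/
theorem norm_wittToC_le_one (hp : valuation F p < 1) (x : WittVector p (ResidueField (maxUnramifiedCompletion F))) :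
    ‖wittToC F p hp x‖ ≤ 1 := by
  haveI : Fact (¬ IsUnit (p : maxUnramifiedCompletion F)) := ⟨not_isUnit_natCast_completion hp⟩
  haveI : CharP (ResidueField (maxUnramifiedCompletion F)) p := charP_residueField_completion
  haveI : Fact (¬ IsUnit (p : integerC F)) := ⟨not_isUnit_natCast_integerC hp⟩
  haveI : IsAdicComplete (Ideal.span {(p : integerC F)}) (integerC F) := isAdicComplete_integerC_natCast hp
  rw [wittToC_apply]
  exact norm_coe_integerC_le _

/-- **`W(k̄) → ℂ_F` is `Γ_F`-equivariant**: `σ (wittToC x) = wittToC (𝕎(σ̄) x)` (equivariance of `wittToAinf`,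
tree `galAinf_wittToAinf`, and of `θ`, tree `fontaineTheta_galAinf`). [cite: FontaineAsterisque223III, Exp. II §1.2] -/
theorem smul_wittToC (hp : valuation F p < 1) (σ : absoluteGaloisGroup F)
    (x : WittVector p (ResidueField (maxUnramifiedCompletion F))) :
    σ • wittToC F p hp x = wittToC F p hp (wittGal σ x) := by
  haveI : Fact (¬ IsUnit (p : maxUnramifiedCompletion F)) := ⟨not_isUnit_natCast_completion hp⟩
  haveI : CharP (ResidueField (maxUnramifiedCompletion F)) p := charP_residueField_completion
  haveI : Fact (¬ IsUnit (p : integerC F)) := ⟨not_isUnit_natCast_integerC hp⟩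
  haveI : IsAdicComplete (Ideal.span {(p : integerC F)}) (integerC F) := isAdicComplete_integerC_natCast hp
  rw [wittToC_apply, wittToC_apply, ← coe_galInt, ← fontaineTheta_galAinf, galAinf_wittToAinf]
  rfl

/-! ## §2 The fixed Witt vectors `W(k̄)^{Γ_F}` -/

variable (F p) in
/-- **`W(k_F) := W(k̄)^{Γ_F}`**, the subring of Witt vectors over `k̄` fixed by every `𝕎(σ̄)`, `σ ∈ Γ_F` — the ring of
integers of the maximal unramified subfield of `F`, realised inside `W(k̄)`. [cite: SerreLocalFields1979, Ch. II §5 Thm. 4] -/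
def wittFixed : Subring (WittVector p (ResidueField (maxUnramifiedCompletion F))) :=
  ⨅ σ : absoluteGaloisGroup F, (wittGal (p := p) σ).eqLocus (RingHom.id _)

omit [CharZero F] in
/-- Membership in `W(k̄)^{Γ_F}`. [cite: SerreLocalFields1979, Ch. II §5 Thm. 4] -/
theorem mem_wittFixed_iff {x : WittVector p (ResidueField (maxUnramifiedCompletion F))} :
    x ∈ wittFixed F p ↔ ∀ σ : absoluteGaloisGroup F, wittGal σ x = x := by
  rw [wittFixed, Subring.mem_iInf]
  exact Iff.rfl

omit [CharZero F] in
/-- Elements of `W(k̄)^{Γ_F}` are fixed. [cite: SerreLocalFields1979, Ch. II §5 Thm. 4] -/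
@[simp] theorem wittGal_coe_wittFixed (σ : absoluteGaloisGroup F) (x : wittFixed F p) :
    wittGal σ (x : WittVector p (ResidueField (maxUnramifiedCompletion F))) = x :=
  (mem_wittFixed_iff.1 x.2) σ

omit [CharZero F] in
/-- **Teichmüller lifts of `k̄^{Γ_F} = k_F` lie in `W(k̄)^{Γ_F}`.** [cite: SerreLocalFields1979, Ch. II §5 Prop. 8] -/
theorem teichmuller_mem_wittFixed {y : ResidueField (maxUnramifiedCompletion F)}
    (hy : ∀ σ : absoluteGaloisGroup F, residueGal σ y = y) : teichmuller p y ∈ wittFixed F p := by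
  refine mem_wittFixed_iff.2 fun σ => ?_
  rw [wittGal, WittVector.map_teichmuller, hy σ]

omit [CharZero F] in
/-- `ℤ_p ⊆ W(k̄)^{Γ_F}` (tree `padicIntToWitt`, `wittGal_padicIntToWitt`). [cite: SerreLocalFields1979, Ch. II §5 Prop. 10] -/
theorem padicIntToWitt_mem_wittFixed [CharP (ResidueField (maxUnramifiedCompletion F)) p] (z : ℤ_[p]) :
    padicIntToWitt F p z ∈ wittFixed F p :=
  mem_wittFixed_iff.2 fun σ => wittGal_padicIntToWitt σ z

/-! ## §3 `W(k̄)^{Γ_F} → 𝒪_F ⊆ F` -/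

/-- The image in `ℂ_F` of a fixed Witt vector is `Γ_F`-fixed. [cite: FontaineAsterisque223III, Exp. II §1.2] -/
theorem smul_wittToC_of_mem (hp : valuation F p < 1) {x : WittVector p (ResidueField (maxUnramifiedCompletion F))}
    (hx : x ∈ wittFixed F p) (σ : absoluteGaloisGroup F) : σ • wittToC F p hp x = wittToC F p hp x := by
  rw [smul_wittToC, (mem_wittFixed_iff.1 hx) σ]

/-- **The image in `ℂ_F` of a fixed Witt vector lies in `F`** (Ax–Sen–Tate `ℂ_F^{Γ_F} = F`, tree
`CompletedAlgClosure.fixedPoints_eq_range_algebraMap`). [cite: FontaineOuyang2022, Prop. 3.8] -/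
theorem wittToC_mem_range_of_mem (hp : valuation F p < 1) {x : WittVector p (ResidueField (maxUnramifiedCompletion F))}
    (hx : x ∈ wittFixed F p) : wittToC F p hp x ∈ Set.range (algebraMap F (CompletedAlgClosure F)) := by
  rw [← CompletedAlgClosure.fixedPoints_eq_range_algebraMap]
  exact fun σ => smul_wittToC_of_mem hp hx σ

/-- `F ≃ (its image in ℂ_F)`, the range restriction of the (injective) `algebraMap F ℂ_F`. [folklore] -/
private def rangeEquiv : F ≃+* (algebraMap F (CompletedAlgClosure F)).range :=
  RingEquiv.ofBijective (algebraMap F (CompletedAlgClosure F)).rangeRestrict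
    ⟨fun _ _ h => (algebraMap F (CompletedAlgClosure F)).injective (congrArg Subtype.val h :),
      RingHom.rangeRestrict_surjective _⟩

variable (F p) in
/-- **`W(k_F) = W(k̄)^{Γ_F} → F`**: a fixed Witt vector `x` goes to the unique `a ∈ F` with `a = θ(𝕎(ι₀♭) x)` in
`ℂ_F`. [cite: SerreLocalFields1979, Ch. II §5 Thm. 4] -/
def wittFixedToF (hp : valuation F p < 1) : wittFixed F p →+* F :=
  (rangeEquiv (F := F)).symm.toRingHom.comp
    (((wittToC F p hp).comp (wittFixed F p).subtype).codRestrict (algebraMap F (CompletedAlgClosure F)).range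
      fun x => RingHom.mem_range.2 (wittToC_mem_range_of_mem hp x.2))

/-- **`wittFixedToF x = wittToC x` in `ℂ_F`.** [cite: SerreLocalFields1979, Ch. II §5 Thm. 4] -/
theorem algebraMap_wittFixedToF (hp : valuation F p < 1) (x : wittFixed F p) :
    algebraMap F (CompletedAlgClosure F) (wittFixedToF F p hp x) =
      wittToC F p hp (x : WittVector p (ResidueField (maxUnramifiedCompletion F))) := by
  set y : (algebraMap F (CompletedAlgClosure F)).range :=
    ⟨wittToC F p hp (x : WittVector p (ResidueField (maxUnramifiedCompletion F))),
      RingHom.mem_range.2 (wittToC_mem_range_of_mem hp x.2)⟩ with hy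
  have h1 : wittFixedToF F p hp x = (rangeEquiv (F := F)).symm y := rfl
  have h2 : (rangeEquiv (F := F)) ((rangeEquiv (F := F)).symm y) = y := RingEquiv.apply_symm_apply _ _
  have h3 := congrArg Subtype.val h2
  rw [rangeEquiv, RingEquiv.ofBijective_apply, RingHom.coe_rangeRestrict] at h3
  rw [h1]
  exact h3

/-- `‖wittFixedToF x‖ ≤ 1` in `ℂ_F`. [cite: SerreLocalFields1979, Ch. II §5 Thm. 4] -/
theorem norm_algebraMap_wittFixedToF_le_one (hp : valuation F p < 1) (x : wittFixed F p) :
    ‖algebraMap F (CompletedAlgClosure F) (wittFixedToF F p hp x)‖ ≤ 1 := by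
  rw [algebraMap_wittFixedToF]
  exact norm_wittToC_le_one hp _

/-- **`W(k̄)^{Γ_F} → F` lands in `𝒪_F`.** [cite: SerreLocalFields1979, Ch. II §5 Thm. 4] -/
theorem wittFixedToF_mem_integer (hp : valuation F p < 1) (x : wittFixed F p) : wittFixedToF F p hp x ∈ 𝒪[F] := by
  have h := norm_algebraMap_wittFixedToF_le_one hp x
  rw [CompletedAlgClosure.norm_algebraMap] at h
  exact (norm_le_one_iff F _).mp h

variable (F p) in
/-- **`W(k_F) = W(k̄)^{Γ_F} → 𝒪_F`.** [cite: SerreLocalFields1979, Ch. II §5 Thm. 4] -/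
def wittFixedToInt (hp : valuation F p < 1) : wittFixed F p →+* 𝒪[F] :=
  (wittFixedToF F p hp).codRestrict 𝒪[F] (wittFixedToF_mem_integer hp)

/-- Unfolding `wittFixedToInt`. [cite: SerreLocalFields1979, Ch. II §5 Thm. 4] -/
@[simp] theorem coe_wittFixedToInt (hp : valuation F p < 1) (x : wittFixed F p) :
    ((wittFixedToInt F p hp x : 𝒪[F]) : F) = wittFixedToF F p hp x := rfl

/-- `‖wittFixedToF (p z)‖ ≤ ‖p‖`: multiples of `p` go to `p𝒪_F`. [cite: SerreLocalFields1979, Ch. II §5 Thm. 4] -/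
theorem norm_algebraMap_wittFixedToF_le_of_dvd (hp : valuation F p < 1) {c : wittFixed F p}
    (hc : (p : wittFixed F p) ∣ c) :
    ‖algebraMap F (CompletedAlgClosure F) (wittFixedToF F p hp c)‖ ≤ ‖(p : CompletedAlgClosure F)‖ := by
  obtain ⟨d, rfl⟩ := hc
  rw [map_mul, map_natCast, map_mul, map_natCast, norm_mul]
  exact mul_le_of_le_one_right (norm_nonneg _) (norm_algebraMap_wittFixedToF_le_one hp d)

/-- `‖wittFixedToF u‖ = 1` for a unit `u` of `W(k̄)^{Γ_F}`. [cite: SerreLocalFields1979, Ch. II §5 Thm. 4] -/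
theorem norm_algebraMap_wittFixedToF_unit (hp : valuation F p < 1) (u : (wittFixed F p)ˣ) :
    ‖algebraMap F (CompletedAlgClosure F) (wittFixedToF F p hp (u : wittFixed F p))‖ = 1 := by
  have h1 := norm_algebraMap_wittFixedToF_le_one hp (u : wittFixed F p)
  have h2 := norm_algebraMap_wittFixedToF_le_one hp (↑u⁻¹ : wittFixed F p)
  have hmul : ‖algebraMap F (CompletedAlgClosure F) (wittFixedToF F p hp (u : wittFixed F p))‖ *
      ‖algebraMap F (CompletedAlgClosure F) (wittFixedToF F p hp (↑u⁻¹ : wittFixed F p))‖ = 1 := by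
    rw [← norm_mul, ← map_mul, ← map_mul, Units.mul_inv, map_one, map_one, norm_one]
  by_contra hne
  have hlt : ‖algebraMap F (CompletedAlgClosure F) (wittFixedToF F p hp (u : wittFixed F p))‖ < 1 := lt_of_le_of_ne h1 hne
  have : ‖algebraMap F (CompletedAlgClosure F) (wittFixedToF F p hp (u : wittFixed F p))‖ *
      ‖algebraMap F (CompletedAlgClosure F) (wittFixedToF F p hp (↑u⁻¹ : wittFixed F p))‖ < 1 :=
    mul_lt_one_of_nonneg_of_lt_one_left (norm_nonneg _) hlt h2
  exact absurd hmul this.ne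

variable (F p) in
/-- **`W(k̄)^{Γ_F} → 𝒪_{ℂ_F}`** (`wittToC` with its values in the unit ball). [cite: FontaineAsterisque223III, Exp. II §1.2] -/
def wittFixedToIntC (hp : valuation F p < 1) : wittFixed F p →+* integerC F :=
  ((wittToC F p hp).comp (wittFixed F p).subtype).codRestrict (integerC F)
    fun _ => (mem_integerC_iff).2 (norm_wittToC_le_one hp _)

/-- `wittFixedToIntC x = wittToC x = wittFixedToF x` in `ℂ_F`. [cite: FontaineAsterisque223III, Exp. II §1.2] -/
theorem coe_wittFixedToIntC (hp : valuation F p < 1) (x : wittFixed F p) :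
    ((wittFixedToIntC F p hp x : integerC F) : CompletedAlgClosure F) =
      algebraMap F (CompletedAlgClosure F) (wittFixedToF F p hp x) := by
  rw [algebraMap_wittFixedToF]; rfl

/-- `Γ_F` fixes `wittFixedToIntC x`. [cite: FontaineAsterisque223III, Exp. II §1.2] -/
theorem galInt_wittFixedToIntC (hp : valuation F p < 1) (σ : absoluteGaloisGroup F) (x : wittFixed F p) :
    galInt σ (wittFixedToIntC F p hp x) = wittFixedToIntC F p hp x := by
  apply Subtype.ext
  rw [coe_galInt, coe_wittFixedToIntC, CompletedAlgClosure.smul_algebraMap]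

/-! ## §4 `W(k̄)^{Γ_F} → 𝔸_inf(F)` -/

section Ainf

variable [Fact (¬ IsUnit (p : integerC F))]

variable (F p) in
/-- **`W(k_F) = W(k̄)^{Γ_F} → 𝔸_inf(F)`**, the restriction of the tree map `wittToAinf` (the instance facts about
`𝒪̂_{F^nr}` supplied from `hp`): the coefficient embedding of `𝒪_F ⊗_{W(k_F)} 𝔸_inf(F)`. [cite: FontaineAsterisque223III, Exp. II §1.2] -/
def wittFixedToAinf (hp : valuation F p < 1) : wittFixed F p →+* Ainf (p := p) F :=
  haveI : Fact (¬ IsUnit (p : maxUnramifiedCompletion F)) := ⟨not_isUnit_natCast_completion hp⟩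
  haveI : CharP (ResidueField (maxUnramifiedCompletion F)) p := charP_residueField_completion
  (wittToAinf F p).comp (wittFixed F p).subtype

/-- `wittFixedToAinf x = wittToAinf x`. [cite: FontaineAsterisque223III, Exp. II §1.2] -/
theorem wittFixedToAinf_apply [Fact (¬ IsUnit (p : maxUnramifiedCompletion F))]
    [CharP (ResidueField (maxUnramifiedCompletion F)) p] (hp : valuation F p < 1) (x : wittFixed F p) :
    wittFixedToAinf F p hp x = wittToAinf F p (x : WittVector p (ResidueField (maxUnramifiedCompletion F))) := rfl

/-- **`Γ_F` fixes `W(k_F) ⊆ 𝔸_inf(F)`**: `𝕎(σ♭) (wittFixedToAinf x) = wittFixedToAinf x`. [cite: FontaineAsterisque223III, Exp. II §1.2] -/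
theorem galAinf_wittFixedToAinf (hp : valuation F p < 1) (σ : absoluteGaloisGroup F) (x : wittFixed F p) :
    galAinf σ (wittFixedToAinf F p hp x) = wittFixedToAinf F p hp x := by
  haveI : Fact (¬ IsUnit (p : maxUnramifiedCompletion F)) := ⟨not_isUnit_natCast_completion hp⟩
  haveI : CharP (ResidueField (maxUnramifiedCompletion F)) p := charP_residueField_completion
  rw [wittFixedToAinf_apply, galAinf_wittToAinf]
  exact congrArg (wittToAinf F p) (wittGal_coe_wittFixed σ x)

/-- As ring maps: `𝕎(σ♭) ∘ wittFixedToAinf = wittFixedToAinf`. [cite: FontaineAsterisque223III, Exp. II §1.2] -/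
theorem galAinf_comp_wittFixedToAinf (hp : valuation F p < 1) (σ : absoluteGaloisGroup F) :
    (galAinf σ).comp (wittFixedToAinf F p hp) = wittFixedToAinf F p hp := RingHom.ext (galAinf_wittFixedToAinf hp σ)

variable [IsAdicComplete (Ideal.span {(p : integerC F)}) (integerC F)]

/-- **`θ ∘ wittFixedToAinf = wittFixedToIntC`**: `θ` of the coefficient `x ∈ W(k_F) ⊆ 𝔸_inf` is `x ∈ 𝒪_F ⊆ 𝒪_{ℂ_F}`.
[cite: FontaineAsterisque223III, Exp. II §1.2] -/
theorem fontaineTheta_wittFixedToAinf (hp : valuation F p < 1) (x : wittFixed F p) :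
    fontaineTheta (integerC F) p (wittFixedToAinf F p hp x) = wittFixedToIntC F p hp x := by
  haveI : Fact (¬ IsUnit (p : maxUnramifiedCompletion F)) := ⟨not_isUnit_natCast_completion hp⟩
  haveI : CharP (ResidueField (maxUnramifiedCompletion F)) p := charP_residueField_completion
  exact Subtype.ext rfl

/-- The same in `ℂ_F`: `θ (wittFixedToAinf x) = wittFixedToF x`. [cite: FontaineAsterisque223III, Exp. II §1.2] -/
theorem coe_fontaineTheta_wittFixedToAinf (hp : valuation F p < 1) (x : wittFixed F p) :
    ((fontaineTheta (integerC F) p (wittFixedToAinf F p hp x) : integerC F) : CompletedAlgClosure F) =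
      algebraMap F (CompletedAlgClosure F) (wittFixedToF F p hp x) := by
  rw [fontaineTheta_wittFixedToAinf, coe_wittFixedToIntC]

/-- As ring maps: `θ ∘ wittFixedToAinf = wittFixedToIntC`. [cite: FontaineAsterisque223III, Exp. II §1.2] -/
theorem fontaineTheta_comp_wittFixedToAinf (hp : valuation F p < 1) :
    (fontaineTheta (integerC F) p).comp (wittFixedToAinf F p hp) = wittFixedToIntC F p hp :=
  RingHom.ext (fontaineTheta_wittFixedToAinf hp)

end Ainf

end Literature.NumberTheory.PAdicHodge

end
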